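import Summits.BirchSwinnertonDyer.BirchSwinnertonDyer.Theorems.ManinLocalTwoThreeHalfLatticeVelu
import Summits.BirchSwinnertonDyer.BirchSwinnertonDyer.Theorems.ManinLocalTwoThreeAtMostOneBlindRoot
import Literature.NumberTheory.Automorphic.ShimuraCurveRibetTakahashiOptimalProofs
import HarnessLib

/-!
# The converse Vélu step: if the Vélu quotient model descends at `2`, the `2`-torsion point is Kummer-BLIND
# (the hard direction of the `KummerBlindAtTwo` dictionary, for globally minimal `y² = x³ + a₂x² + a₄x + a₆`)

Summit `BirchSwinnertonDyer`, route `ManinLocalTwoThree` (cell bsd-f2-manin), deciding crux C2 `ManinOddAtFour`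
(stmt-BirchSwinnertonDyer-22967); lead p1 gen 14.  The cell's dictionary (docstring of
`CuspidalKummer.KummerBlindAtTwo`, an g14; audited by ref1 §R145 as «L5», minimality load-bearing): for a globally minimal
`W₀ : y² = x³ + a₂x² + a₄x + a₆` with an integral root `e` of the cubic (`T = (e, 0)` a rational `2`-torsion point),
`A := a₂ + 3e`, `B := 3e² + 2a₂e + a₄`, and Vélu's model `V = [0, −2A, 0, A² − 4B, 0]` of `W₀/⟨T⟩` (the model with
`φ_T^* ω_V = ω₀`):

  `T` is Kummer-blind (`2 ∣ A`, `16 ∣ A² − 4B`)  ⟺  `V` is NOT minimal at `2`.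

The tree has `⟹` (the `u = 2` rescaling is visibly integral; used in `false_of_blind_halfPeriod_neronLattice`, p634444).  THIS FILE
proves `⟸` in the form the Γ₀/Γ₁ ledger needs: if a globally minimal `W₁` has `c₄(W₁) = c₄(V)/2⁴` and `c₆(W₁) = c₆(V)/2⁶`
(i.e. `W₁` is a `u = ±2` descent of `V`), then `T` is Kummer-blind (`kummerBlindAtTwo_of_velu_descent`).

THE ARGUMENT.  `W₁ = C • V` with `u(C)² = 4` (`exists_variableChange_of_c₄_eq_of_c₆_eq` + the discriminants); writing the
integral coefficients of `W₁` through Silverman's Table 3.1 gives integers `m₁ = a₁'`, `m₂ = a₂'`, `m₃ = a₃'`, `R = 3r = 4m₂ + 2A + m₁²`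
with `16 ∣ 3A² − 12B − 4AR + R² − 24m₁m₃` (`a₄' ∈ ℤ`) and `64 ∣ 9R(A² − 4B) − 6AR² + R³ − 432m₃²` (`a₆' ∈ ℤ`).  Residue
arithmetic mod `64` (`blind_or_descent_of_velu_congruences`) leaves two configurations: BLIND, or `A ≡ 1 (mod 4) ∧ 16 ∣ B` — and in
the latter `⟨2; e, 1, 0⟩ • W₀ = [1, (A−1)/4, 0, B/16, 0]` is an integral model with discriminant `2⁻¹²Δ(W₀)`, contradicting the
minimality of `W₀` at `2` (`padicValInt_minimalDiscriminantInt_le_padicValRat_Δ_smul`, p618249).  (Without the minimality of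
`W₀` the dictionary fails: `A = 1`, `B = 16`.)

HONEST FRAMING: local algebra at `2`; no Manin constant is decided; C2, Manin's conjecture and BSD are not proved.  No definitions,
no named facts, no sorry.  References: [SilvermanAEC2009] III.1 Table 3.1, VII.1; HOME/MEMO-an.md §56/§78.11 (L5); ref1 §R145.
-/

set_option autoImplicit false
-- the summit-side namespace `Summit.BirchSwinnertonDyer.BirchSwinnertonDyer.…` is the tree's (summit = sub-problem)
set_option linter.dupNamespace false

noncomputable section

open WeierstrassCurve Literature.NumberTheory.EllipticCurves Literature.NumberTheory.EllipticCurves.ModularForms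
open Summit.BirchSwinnertonDyer.Rank1Residual.ManinAdditive.CuspidalKummer

namespace Summit.BirchSwinnertonDyer.BirchSwinnertonDyer.Theorems.ManinLocalTwoThree

/-! ## §1 Residue arithmetic mod `64` -/

/-- **Arithmetic core of the Vélu descent.**  If the `u = 2` descent `[u; r, s, t] • V` of the Vélu model
`V = [0, −2A, 0, A² − 4B, 0]` is integral — encoded by the integers `m₁ = a₁'`, `m₂ = a₂'`, `m₃ = a₃'`, `R = 3r = 4m₂ + 2A + m₁²`
and the two divisibilities expressing `a₄', a₆' ∈ ℤ` — then either the `2`-torsion point is Kummer-blind (`2 ∣ A`, `16 ∣ A² − 4B`) or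
`A ≡ 1 (mod 4)` and `16 ∣ B` (the configuration in which the ORIGINAL curve `[0, A, 0, B, 0]` descends).  Pure residue arithmetic
modulo `64`. [folklore] -/
theorem blind_or_descent_of_velu_congruences (A B R m₁ m₂ m₃ : ℤ) (hR : R = 4 * m₂ + 2 * A + m₁ ^ 2)
    (h4 : (16 : ℤ) ∣ 3 * A ^ 2 - 12 * B - 4 * A * R + R ^ 2 - 24 * m₁ * m₃)
    (h6 : (64 : ℤ) ∣ 9 * R * (A ^ 2 - 4 * B) - 6 * A * R ^ 2 + R ^ 3 - 432 * m₃ ^ 2) :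
    (2 ∣ A ∧ 16 ∣ A ^ 2 - 4 * B) ∨ (A % 4 = 1 ∧ 16 ∣ B) := by
  obtain ⟨q₄, hq₄⟩ := h4
  obtain ⟨q₆, hq₆⟩ := h6
  rcases Int.even_or_odd' m₁ with ⟨k, hk | hk⟩ <;> rcases Int.even_or_odd' A with ⟨a, ha | ha⟩
  · -- `m₁ = 2k`, `A = 2a`: blind
    left
    obtain ⟨X, hX⟩ : ∃ X : ℤ, 3 * A ^ 2 - 12 * B - 4 * A * R + R ^ 2 - 24 * m₁ * m₃ = 12 * (a ^ 2 - B) + 16 * X :=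
      ⟨(m₂ + a + k ^ 2) ^ 2 - 2 * (a * (m₂ + a + k ^ 2)) - 3 * (k * m₃), by rw [hR, hk, ha]; ring⟩
    rw [hX] at hq₄
    have hd : (4 : ℤ) ∣ a ^ 2 - B := by omega
    obtain ⟨d, hd⟩ := hd
    exact ⟨⟨a, by omega⟩, ⟨d, by rw [ha]; linear_combination (4 : ℤ) * hd⟩⟩
  · -- `m₁ = 2k`, `A = 2a + 1`: the `a₄'`-congruence is `≡ 3 (mod 4)` — impossible
    exfalso
    obtain ⟨X, hX⟩ : ∃ X : ℤ, 3 * A ^ 2 - 12 * B - 4 * A * R + R ^ 2 - 24 * m₁ * m₃ = -1 + 4 * X :=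
      ⟨3 * a ^ 2 - a - 3 * B - 8 * (a * (m₂ + a + k ^ 2)) + 4 * (m₂ + a + k ^ 2) ^ 2 - 12 * (k * m₃),
        by rw [hR, hk, ha]; ring⟩
    rw [hX] at hq₄; omega
  · -- `m₁ = 2k + 1`, `A = 2a`: the `a₄'`-congruence is odd — impossible
    exfalso
    obtain ⟨X, hX⟩ : ∃ X : ℤ, 3 * A ^ 2 - 12 * B - 4 * A * R + R ^ 2 - 24 * m₁ * m₃ = 1 + 2 * X :=
      ⟨6 * a ^ 2 - 6 * B - 16 * (a * (m₂ + a + k ^ 2 + k)) - 4 * a + 8 * (m₂ + a + k ^ 2 + k) ^ 2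
          + 4 * (m₂ + a + k ^ 2 + k) - 24 * (k * m₃) - 12 * m₃, by rw [hR, hk, ha]; ring⟩
    rw [hX] at hq₄; omega
  · -- `m₁ = 2k + 1`, `A = 2a + 1`, `R = 4ρ + 3`
    right
    set ρ : ℤ := m₂ + a + k ^ 2 + k with hρ
    have hR' : R = 4 * ρ + 3 := by rw [hR, hk, ha, hρ]; ring
    clear_value ρ
    rcases Int.even_or_odd' a with ⟨α, hα | hα⟩
    · -- `a = 2α`, `A = 4α + 1`
      refine ⟨by rw [ha, hα]; omega, ?_⟩
      -- `B` is even (the `a₄'`-congruence mod 8)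
      obtain ⟨X₁, hX₁⟩ : ∃ X : ℤ, 3 * A ^ 2 - 12 * B - 4 * A * R + R ^ 2 - 24 * m₁ * m₃ = -12 * B + 8 * X :=
        ⟨6 * α ^ 2 - 3 * α + ρ + 2 * ρ ^ 2 - 8 * (α * ρ) - 3 * m₃ - 6 * (k * m₃), by rw [hR', ha, hα, hk]; ring⟩
      have hB2 : (2 : ℤ) ∣ B := by rw [hX₁] at hq₄; omega
      obtain ⟨b, hb⟩ := hB2
      -- parity relation `α + b + ρ + m₃ ≡ 0 (mod 2)` (the `a₄'`-congruence mod 16)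
      obtain ⟨X₂, hX₂⟩ : ∃ X : ℤ, 3 * A ^ 2 - 12 * B - 4 * A * R + R ^ 2 - 24 * m₁ * m₃
          = 8 * (-3 * α - 3 * b + ρ - 3 * m₃) + 16 * X :=
        ⟨3 * α ^ 2 + ρ ^ 2 - 4 * (α * ρ) - 3 * (k * m₃), by rw [hR', ha, hα, hk, hb]; ring⟩
      have hP1 : (2 : ℤ) ∣ α + b + ρ + m₃ := by rw [hX₂] at hq₄; omega
      -- `b` is even (the `a₆'`-congruence mod 16)
      obtain ⟨Z₁, hZ₁⟩ : ∃ Z : ℤ, 9 * R * (A ^ 2 - 4 * B) - 6 * A * R ^ 2 + R ^ 3 - 432 * m₃ ^ 2 = -216 * b + 16 * Z :=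
        ⟨27 * α ^ 2 - 18 * (α * ρ) + 36 * (α ^ 2 * ρ) - 18 * (b * ρ) - 24 * (α * ρ ^ 2) + 3 * ρ ^ 2 + 4 * ρ ^ 3
            - 27 * m₃ ^ 2, by rw [hR', ha, hα, hb]; ring⟩
      have hb2 : (2 : ℤ) ∣ b := by rw [hZ₁] at hq₆; omega
      obtain ⟨b', hb'⟩ := hb2
      -- `b'` is even (the `a₆'`-congruence mod 32 with the parity relation)
      obtain ⟨Z₂, hZ₂⟩ : ∃ Z : ℤ, 9 * R * (A ^ 2 - 4 * B) - 6 * A * R ^ 2 + R ^ 3 - 432 * m₃ ^ 2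
          = 16 * (α ^ 2 + b' + ρ ^ 2 + m₃ ^ 2) + 32 * Z :=
        ⟨13 * α ^ 2 - 14 * b' - 9 * (α * ρ) + 18 * (α ^ 2 * ρ) - 18 * (b' * ρ) - 12 * (α * ρ ^ 2) + ρ ^ 2
            + 2 * ρ ^ 3 - 14 * m₃ ^ 2, by rw [hR', ha, hα, hb, hb']; ring⟩
      obtain ⟨cα, hcα⟩ := Int.even_mul_succ_self α
      obtain ⟨cρ, hcρ⟩ := Int.even_mul_succ_self ρ
      obtain ⟨cm, hcm⟩ := Int.even_mul_succ_self m₃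
      have hsα : α ^ 2 + α = cα + cα := by rw [← hcα]; ring
      have hsρ : ρ ^ 2 + ρ = cρ + cρ := by rw [← hcρ]; ring
      have hsm : m₃ ^ 2 + m₃ = cm + cm := by rw [← hcm]; ring
      have hb'2 : (2 : ℤ) ∣ b' := by
        rw [hZ₂] at hq₆
        generalize α ^ 2 = sα at hsα hq₆
        generalize ρ ^ 2 = sρ at hsρ hq₆
        generalize m₃ ^ 2 = sm at hsm hq₆
        omega
      obtain ⟨b'', hb''⟩ := hb'2
      -- `b''` is even (the `a₆'`-congruence mod 64 with the parity relation): `B = 16 b'''`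
      obtain ⟨Z₃, hZ₃⟩ : ∃ Z : ℤ, 9 * R * (A ^ 2 - 4 * B) - 6 * A * R ^ 2 + R ^ 3 - 432 * m₃ ^ 2
          = 16 * (3 * α ^ 2 + 2 * b'' + 2 * (α * ρ) + 3 * ρ ^ 2 + m₃ ^ 2) + 64 * Z :=
        ⟨6 * α ^ 2 - 14 * b'' - 5 * (α * ρ) + 9 * (α ^ 2 * ρ) - 18 * (b'' * ρ) - 6 * (α * ρ ^ 2) + ρ ^ 3
            - 7 * m₃ ^ 2, by rw [hR', ha, hα, hb, hb', hb'']; ring⟩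
      have hT : (4 : ℤ) ∣ 3 * α ^ 2 + 2 * b'' + 2 * (α * ρ) + 3 * ρ ^ 2 + m₃ ^ 2 := by rw [hZ₃] at hq₆; omega
      have hb''2 : (2 : ℤ) ∣ b'' := by
        rcases Int.even_or_odd' α with ⟨α₁, rfl | rfl⟩ <;> rcases Int.even_or_odd' ρ with ⟨ρ₁, rfl | rfl⟩ <;>
          rcases Int.even_or_odd' m₃ with ⟨μ, rfl | rfl⟩
        all_goals
          first
          | (exfalso; omega)
          | skip
        · have e1 : (2 * α₁) ^ 2 = 4 * α₁ ^ 2 := by ring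
          have e2 : (2 * α₁) * (2 * ρ₁) = 4 * (α₁ * ρ₁) := by ring
          have e3 : (2 * ρ₁) ^ 2 = 4 * ρ₁ ^ 2 := by ring
          have e4 : (2 * μ) ^ 2 = 4 * μ ^ 2 := by ring
          rw [e1, e2, e3, e4] at hT; omega
        · have e1 : (2 * α₁) ^ 2 = 4 * α₁ ^ 2 := by ring
          have e2 : (2 * α₁) * (2 * ρ₁ + 1) = 2 * (α₁ * (2 * ρ₁ + 1)) := by ring
          have e3 : (2 * ρ₁ + 1) ^ 2 = 4 * (ρ₁ ^ 2 + ρ₁) + 1 := by ring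
          have e4 : (2 * μ + 1) ^ 2 = 4 * (μ ^ 2 + μ) + 1 := by ring
          rw [e1, e2, e3, e4] at hT; omega
        · have e1 : (2 * α₁ + 1) ^ 2 = 4 * (α₁ ^ 2 + α₁) + 1 := by ring
          have e2 : (2 * α₁ + 1) * (2 * ρ₁) = 2 * ((2 * α₁ + 1) * ρ₁) := by ring
          have e3 : (2 * ρ₁) ^ 2 = 4 * ρ₁ ^ 2 := by ring
          have e4 : (2 * μ + 1) ^ 2 = 4 * (μ ^ 2 + μ) + 1 := by ring
          rw [e1, e2, e3, e4] at hT; omega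
        · have e1 : (2 * α₁ + 1) ^ 2 = 4 * (α₁ ^ 2 + α₁) + 1 := by ring
          have e2 : (2 * α₁ + 1) * (2 * ρ₁ + 1) = 4 * (α₁ * ρ₁) + 2 * α₁ + 2 * ρ₁ + 1 := by ring
          have e3 : (2 * ρ₁ + 1) ^ 2 = 4 * (ρ₁ ^ 2 + ρ₁) + 1 := by ring
          have e4 : (2 * μ) ^ 2 = 4 * μ ^ 2 := by ring
          rw [e1, e2, e3, e4] at hT; omega
      obtain ⟨b''', hb'''⟩ := hb''2
      exact ⟨b''', by rw [hb, hb', hb'', hb''']; ring⟩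
    · -- `a = 2α + 1`, `A ≡ 3 (mod 4)`: `B` would be both even (`a₄'`) and odd (`a₆'`)
      exfalso
      obtain ⟨X, hX⟩ : ∃ X : ℤ, 3 * A ^ 2 - 12 * B - 4 * A * R + R ^ 2 - 24 * m₁ * m₃
          = -12 * B + 8 * (α - ρ - m₃) + 16 * X :=
        ⟨3 * α ^ 2 + α - ρ + ρ ^ 2 - 4 * (α * ρ) - m₃ - 3 * (k * m₃), by rw [hR', ha, hα, hk]; ring⟩
      obtain ⟨Z, hZ⟩ : ∃ Z : ℤ, 9 * R * (A ^ 2 - 4 * B) - 6 * A * R ^ 2 + R ^ 3 - 432 * m₃ ^ 2 = 4 - 4 * B + 8 * Z :=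
        ⟨13 - 13 * B - 18 * (B * ρ) + 54 * α ^ 2 + 54 * α + 36 * (α * ρ) + 72 * (α ^ 2 * ρ) - 48 * (α * ρ ^ 2)
            - 18 * ρ ^ 2 + 8 * ρ ^ 3 - 54 * m₃ ^ 2, by rw [hR', ha, hα]; ring⟩
      rw [hX] at hq₄; rw [hZ] at hq₆; omega

/-! ## §2 The explicit descent of `W₀` in the exceptional configuration -/

/-- **`A ≡ 1 (mod 4)`, `16 ∣ B` contradict the minimality of `W₀` at `2`.**  For a globally minimal `W₀ : y² = x³ + a₂x² + a₄x + a₆`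
with an integral root `E` of the cubic, `A = a₂ + 3E = 4k + 1` and `B = 3E² + 2a₂E + a₄ = 16ℓ` are impossible: the change
`⟨2; E, 1, 0⟩` produces the INTEGRAL model `[1, k, 0, ℓ, 0]` with discriminant `2⁻¹²Δ(W₀)`. [folklore] -/
theorem false_of_descent_configuration (W₀ : WeierstrassCurve ℚ) [W₀.IsElliptic] [W₀.IsGloballyMinimal]
    (ha₁ : W₀.a₁ = 0) (ha₃ : W₀.a₃ = 0) {A₂ A₄ E : ℤ} (hA₂ : (A₂ : ℚ) = W₀.a₂) (hA₄ : (A₄ : ℚ) = W₀.a₄)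
    (he : (E : ℚ) ^ 3 + W₀.a₂ * (E : ℚ) ^ 2 + W₀.a₄ * E + W₀.a₆ = 0)
    {k ℓ : ℤ} (hk : A₂ + 3 * E = 4 * k + 1) (hℓ : 3 * E ^ 2 + 2 * A₂ * E + A₄ = 16 * ℓ) : False := by
  haveI : Fact (Nat.Prime 2) := ⟨Nat.prime_two⟩
  set C₀ : VariableChange ℚ := ⟨Units.mk0 (2 : ℚ) two_ne_zero, (E : ℚ), 1, 0⟩ with hC₀
  have hu₀ : ((C₀.u⁻¹ : ℚˣ) : ℚ) = (2 : ℚ)⁻¹ := by rw [Units.val_inv_eq_inv_val, hC₀, Units.val_mk0]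
  have hkq : (W₀.a₂ + 3 * E : ℚ) = 4 * k + 1 := by rw [← hA₂]; exact_mod_cast hk
  have hℓq : (3 * (E : ℚ) ^ 2 + 2 * W₀.a₂ * E + W₀.a₄ : ℚ) = 16 * ℓ := by rw [← hA₂, ← hA₄]; exact_mod_cast hℓ
  have h₁' : (C₀ • W₀).a₁ = ((1 : ℤ) : ℚ) := by
    rw [variableChange_a₁, hu₀, ha₁]; simp [hC₀]
  have h₂' : (C₀ • W₀).a₂ = ((k : ℤ) : ℚ) := by
    rw [variableChange_a₂, hu₀, ha₁]
    simp only [hC₀, mul_zero, sub_zero, one_pow]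
    linear_combination (1 / 4 : ℚ) * hkq
  have h₃' : (C₀ • W₀).a₃ = ((0 : ℤ) : ℚ) := by
    rw [variableChange_a₃, hu₀, ha₁, ha₃]; simp [hC₀]
  have h₄' : (C₀ • W₀).a₄ = ((ℓ : ℤ) : ℚ) := by
    rw [variableChange_a₄, hu₀, ha₁, ha₃]
    simp only [hC₀, mul_zero, sub_zero, mul_one]
    linear_combination (1 / 16 : ℚ) * hℓq
  have h₆' : (C₀ • W₀).a₆ = ((0 : ℤ) : ℚ) := by
    rw [variableChange_a₆, hu₀, ha₁, ha₃]
    simp only [hC₀, mul_zero, sub_zero, zero_pow two_ne_zero]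
    push_cast
    linear_combination (1 / 64 : ℚ) * he
  have hle := padicValInt_minimalDiscriminantInt_le_padicValRat_Δ_smul W₀ C₀ 1 k 0 ℓ 0 h₁' h₂' h₃' h₄' h₆' 2
  have hΔ' : (C₀ • W₀).Δ = (2 : ℚ)⁻¹ ^ 12 * (W₀.minimalDiscriminantInt : ℚ) := by
    rw [variableChange_Δ, hu₀, cast_minimalDiscriminantInt]
  have hm : (W₀.minimalDiscriminantInt : ℚ) ≠ 0 := by exact_mod_cast minimalDiscriminantInt_ne_zero W₀
  rw [hΔ', padicValRat.mul (pow_ne_zero _ (inv_ne_zero two_ne_zero)) hm, padicValRat.pow,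
    padicValRat.inv, padicValRat.of_int] at hle
  have h2v : padicValRat 2 (2 : ℚ) = 1 := by exact_mod_cast padicValRat.self (p := 2) one_lt_two
  rw [h2v] at hle
  push_cast at hle
  linarith

/-! ## §3 The converse Vélu step -/

/-- **A `u = ±2` descent of the Vélu model forces Kummer-blindness.**  `W₀ : y² = x³ + a₂x² + a₄x + a₆` globally minimal and
elliptic, `E` an integral root of the cubic (`T = (E, 0)`), `A = a₂ + 3E`, `B = 3E² + 2a₂E + a₄`, `V = [0, −2A, 0, A² − 4B, 0]` Vélu's
model of `W₀/⟨T⟩`.  If a globally minimal `W₁` has `c₄(W₁) = c₄(V)/2⁴` and `c₆(W₁) = c₆(V)/2⁶`, then `T` is Kummer-BLIND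
(`KummerBlindAtTwo a₂ a₄ E`).  Proof in the module docstring.  (`V` is written as `[0, −2(3q), 0, (3q)² − 4B, 0]`, `q = E + a₂/3`,
the shape used by `PeriodPair.lattice_eq_of_velu_invariants`.) [cite: SilvermanAEC2009, §III.1 Table 3.1 and VII.1] -/
theorem kummerBlindAtTwo_of_velu_descent (W₀ : WeierstrassCurve ℚ) [W₀.IsElliptic] [W₀.IsGloballyMinimal]
    (ha₁ : W₀.a₁ = 0) (ha₃ : W₀.a₃ = 0) {A₂ A₄ E : ℤ} (hA₂ : (A₂ : ℚ) = W₀.a₂) (hA₄ : (A₄ : ℚ) = W₀.a₄)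
    (he : (E : ℚ) ^ 3 + W₀.a₂ * (E : ℚ) ^ 2 + W₀.a₄ * E + W₀.a₆ = 0)
    (W₁ : WeierstrassCurve ℚ) [W₁.IsElliptic] [W₁.IsGloballyMinimal]
    (h₄ : W₁.c₄ = ((2 : ℚ) ^ 4)⁻¹ *
      (⟨0, -2 * (3 * ((E : ℚ) + W₀.a₂ / 3)), 0,
        (3 * ((E : ℚ) + W₀.a₂ / 3)) ^ 2 - 4 * (3 * (E : ℚ) ^ 2 + 2 * W₀.a₂ * E + W₀.a₄), 0⟩ : WeierstrassCurve ℚ).c₄)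
    (h₆ : W₁.c₆ = ((2 : ℚ) ^ 6)⁻¹ *
      (⟨0, -2 * (3 * ((E : ℚ) + W₀.a₂ / 3)), 0,
        (3 * ((E : ℚ) + W₀.a₂ / 3)) ^ 2 - 4 * (3 * (E : ℚ) ^ 2 + 2 * W₀.a₂ * E + W₀.a₄), 0⟩ : WeierstrassCurve ℚ).c₆) :
    KummerBlindAtTwo A₂ A₄ E := by
  -- names
  set q : ℚ := (E : ℚ) + W₀.a₂ / 3 with hq
  set Bq : ℚ := 3 * (E : ℚ) ^ 2 + 2 * W₀.a₂ * E + W₀.a₄ with hBq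
  set V : WeierstrassCurve ℚ := ⟨0, -2 * (3 * q), 0, (3 * q) ^ 2 - 4 * Bq, 0⟩ with hV
  set Az : ℤ := A₂ + 3 * E with hAz
  set Bz : ℤ := 3 * E ^ 2 + 2 * A₂ * E + A₄ with hBz
  have hA : (3 * q : ℚ) = (Az : ℚ) := by rw [hq, hAz]; push_cast; rw [← hA₂]; ring
  have hB : Bq = (Bz : ℚ) := by rw [hBq, hBz]; push_cast; rw [← hA₂, ← hA₄]
  -- `V` is elliptic
  have hΔW₀ : W₀.Δ ≠ 0 := by rw [← WeierstrassCurve.coe_Δ']; exact W₀.Δ'.ne_zero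
  have hΔ := Δ_eq_of_isRoot W₀ ha₁ ha₃ he
  have e3 : W₀.a₂ + 3 * (E : ℚ) = 3 * q := by rw [hq]; ring
  rw [e3, ← hBq] at hΔ
  have hB0 : Bq ≠ 0 := by intro h; apply hΔW₀; rw [hΔ, h]; ring
  have hAB : (3 * q) ^ 2 - 4 * Bq ≠ 0 := by intro h; apply hΔW₀; rw [hΔ, h]; ring
  haveI hVell : V.IsElliptic := velu_isElliptic hB0 hAB
  have hΔV : V.Δ ≠ 0 := by rw [← WeierstrassCurve.coe_Δ']; exact V.Δ'.ne_zero
  -- `W₁ = C • V` with `u(C)² = 4`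
  obtain ⟨C, hC⟩ := exists_variableChange_of_c₄_eq_of_c₆_eq (W₁ := V) (W₂ := W₁) (w := 2) two_ne_zero h₄ h₆
  set ui : ℚ := ((C.u⁻¹ : ℚˣ) : ℚ) with hui_def
  set u : ℚ := ((C.u : ℚˣ) : ℚ) with hu_def
  have huu : u * ui = 1 := by rw [hu_def, hui_def, Units.val_inv_eq_inv_val, mul_inv_cancel₀ C.u.ne_zero]
  have hΔ1 : W₁.Δ = ui ^ 12 * V.Δ := by rw [← hC, variableChange_Δ]
  have hΔ2 : W₁.Δ = ((2 : ℚ)⁻¹ ^ 2) ^ 6 * V.Δ := by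
    have h1 := V.c_relation
    have h2 := W₁.c_relation
    rw [h₄, h₆] at h2
    linear_combination (1 / 1728 : ℚ) * h2 - (1 / 1728 / 4096 : ℚ) * h1
  have hui2 : ui ^ 2 = (2 : ℚ)⁻¹ ^ 2 := by
    have h : (ui ^ 2) ^ 6 = ((2 : ℚ)⁻¹ ^ 2) ^ 6 := by
      have h' : (ui ^ 2) ^ 6 * V.Δ = ((2 : ℚ)⁻¹ ^ 2) ^ 6 * V.Δ := by rw [← pow_mul]; exact hΔ1.symm.trans hΔ2
      exact mul_right_cancel₀ hΔV h'
    exact (pow_left_inj₀ (sq_nonneg _) (sq_nonneg _) (by norm_num)).mp h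
  have hu2 : u ^ 2 = 4 := by
    have h : u ^ 2 * ui ^ 2 = 1 := by rw [← mul_pow, huu, one_pow]
    rw [hui2] at h
    linear_combination (4 : ℚ) * h
  -- integer coefficients of `W₁`
  set M : WeierstrassCurve ℤ := integralModelInt W₁ with hM
  have hWM : M.map (Int.castRingHom ℚ) = W₁ := map_integralModelInt W₁
  have hm₁ : W₁.a₁ = (M.a₁ : ℚ) := by rw [← hWM, map_a₁, eq_intCast]
  have hm₂ : W₁.a₂ = (M.a₂ : ℚ) := by rw [← hWM, map_a₂, eq_intCast]
  have hm₃ : W₁.a₃ = (M.a₃ : ℚ) := by rw [← hWM, map_a₃, eq_intCast]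
  have hm₄ : W₁.a₄ = (M.a₄ : ℚ) := by rw [← hWM, map_a₄, eq_intCast]
  have hm₆ : W₁.a₆ = (M.a₆ : ℚ) := by rw [← hWM, map_a₆, eq_intCast]
  -- Silverman's Table 3.1 for `W₁ = C • V`
  have hVa₁ : V.a₁ = 0 := rfl
  have hVa₂ : V.a₂ = -2 * (3 * q) := rfl
  have hVa₃ : V.a₃ = 0 := rfl
  have hVa₄ : V.a₄ = (3 * q) ^ 2 - 4 * Bq := rfl
  have hVa₆ : V.a₆ = 0 := rfl
  have E1 : (M.a₁ : ℚ) = ui * (2 * C.s) := by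
    rw [← hm₁, ← hC, variableChange_a₁, hVa₁, ← hui_def]; ring
  have E2 : (M.a₂ : ℚ) = ui ^ 2 * (-2 * (3 * q) + 3 * C.r - C.s ^ 2) := by
    rw [← hm₂, ← hC, variableChange_a₂, hVa₁, hVa₂, ← hui_def]; ring
  have E3 : (M.a₃ : ℚ) = ui ^ 3 * (2 * C.t) := by
    rw [← hm₃, ← hC, variableChange_a₃, hVa₁, hVa₃, ← hui_def]; ring
  have E4 : (M.a₄ : ℚ) = ui ^ 4 * ((3 * q) ^ 2 - 4 * Bq - 12 * q * C.r + 3 * C.r ^ 2 - 2 * (C.s * C.t)) := by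
    rw [← hm₄, ← hC, variableChange_a₄, hVa₁, hVa₂, hVa₃, hVa₄, ← hui_def]; ring
  have E6 : (M.a₆ : ℚ) = ui ^ 6 * (C.r * ((3 * q) ^ 2 - 4 * Bq) - 6 * q * C.r ^ 2 + C.r ^ 3 - C.t ^ 2) := by
    rw [← hm₆, ← hC, variableChange_a₆, hVa₁, hVa₂, hVa₃, hVa₄, hVa₆, ← hui_def]; ring
  -- `s = u m₁ / 2`, `t = u³ m₃ / 2`, `3r = 4m₂ + 2A + m₁²`
  have hs : 2 * C.s = u * M.a₁ := by linear_combination (-u) * E1 - 2 * C.s * huu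
  have ht : 2 * C.t = u ^ 3 * M.a₃ := by
    linear_combination (-u ^ 3) * E3 - 2 * C.t * (u ^ 2 * ui ^ 2 + u * ui + 1) * huu
  have hs2 : C.s ^ 2 = (M.a₁ : ℚ) ^ 2 := by
    have h : (2 * C.s) ^ 2 = (u * M.a₁) ^ 2 := by rw [hs]
    linear_combination (1 / 4 : ℚ) * h + (1 / 4 : ℚ) * ((M.a₁ : ℚ) ^ 2) * hu2
  have ht2 : C.t ^ 2 = 16 * (M.a₃ : ℚ) ^ 2 := by
    have h : (2 * C.t) ^ 2 = (u ^ 3 * M.a₃) ^ 2 := by rw [ht]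
    have hu6 : u ^ 6 = 64 := by rw [show u ^ 6 = (u ^ 2) ^ 3 by ring, hu2]; norm_num
    linear_combination (1 / 4 : ℚ) * h + (1 / 4 : ℚ) * ((M.a₃ : ℚ) ^ 2) * hu6
  have hst : C.s * C.t = 4 * ((M.a₁ : ℚ) * M.a₃) := by
    have h : (2 * C.s) * (2 * C.t) = (u * M.a₁) * (u ^ 3 * M.a₃) := by rw [hs, ht]
    have hu4 : u ^ 4 = 16 := by rw [show u ^ 4 = (u ^ 2) ^ 2 by ring, hu2]; norm_num
    linear_combination (1 / 4 : ℚ) * h + (1 / 4 : ℚ) * ((M.a₁ : ℚ) * M.a₃) * hu4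
  have hui4 : ui ^ 4 = 1 / 16 := by rw [show ui ^ 4 = (ui ^ 2) ^ 2 by ring, hui2]; norm_num
  have hui6 : ui ^ 6 = 1 / 64 := by rw [show ui ^ 6 = (ui ^ 2) ^ 3 by ring, hui2]; norm_num
  set Rz : ℤ := 4 * M.a₂ + 2 * Az + M.a₁ ^ 2 with hRz
  have hR : 3 * C.r = (Rz : ℚ) := by
    rw [hRz]; push_cast; rw [← hA, ← hs2]
    rw [hui2] at E2
    linear_combination (-4 : ℚ) * E2
  -- the two divisibilities
  have h4q : (48 * M.a₄ : ℚ) = 3 * (Az : ℚ) ^ 2 - 12 * Bz - 4 * Az * Rz + (Rz : ℚ) ^ 2 - 24 * M.a₁ * M.a₃ := by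
    rw [hui4, hst] at E4
    rw [← hR, ← hA, ← hB]
    linear_combination (48 : ℚ) * E4
  have h6q : (1728 * M.a₆ : ℚ) = 9 * (Rz : ℚ) * ((Az : ℚ) ^ 2 - 4 * Bz) - 6 * Az * (Rz : ℚ) ^ 2 + (Rz : ℚ) ^ 3
      - 432 * (M.a₃ : ℚ) ^ 2 := by
    rw [hui6, ht2] at E6
    rw [← hR, ← hA, ← hB]
    linear_combination (1728 : ℚ) * E6
  have h4i : (48 * M.a₄ : ℤ) = 3 * Az ^ 2 - 12 * Bz - 4 * Az * Rz + Rz ^ 2 - 24 * M.a₁ * M.a₃ := by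
    exact_mod_cast h4q
  have h6i : (1728 * M.a₆ : ℤ) = 9 * Rz * (Az ^ 2 - 4 * Bz) - 6 * Az * Rz ^ 2 + Rz ^ 3 - 432 * M.a₃ ^ 2 := by
    exact_mod_cast h6q
  have h4z : (16 : ℤ) ∣ 3 * Az ^ 2 - 12 * Bz - 4 * Az * Rz + Rz ^ 2 - 24 * M.a₁ * M.a₃ :=
    ⟨3 * M.a₄, by linear_combination (-1 : ℤ) * h4i⟩
  have h6z : (64 : ℤ) ∣ 9 * Rz * (Az ^ 2 - 4 * Bz) - 6 * Az * Rz ^ 2 + Rz ^ 3 - 432 * M.a₃ ^ 2 :=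
    ⟨27 * M.a₆, by linear_combination (-1 : ℤ) * h6i⟩
  -- residue arithmetic
  rcases blind_or_descent_of_velu_congruences Az Bz Rz M.a₁ M.a₂ M.a₃ hRz h4z h6z with ⟨h2A, h16⟩ | ⟨hA4, hB16⟩
  · obtain ⟨c, hc⟩ := h2A
    refine ⟨⟨c - E, by rw [hAz] at hc; omega⟩, ?_⟩
    have e : (A₂ + E) ^ 2 - 4 * (A₄ + (A₂ + E) * E) = Az ^ 2 - 4 * Bz := by rw [hAz, hBz]; ring
    rw [e]; exact h16
  · exfalso
    obtain ⟨ℓ, hℓ⟩ := hB16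
    have hk : A₂ + 3 * E = 4 * (Az / 4) + 1 := by rw [hAz] at hA4 ⊢; omega
    have hℓ' : 3 * E ^ 2 + 2 * A₂ * E + A₄ = 16 * ℓ := by rw [← hBz]; exact hℓ
    exact false_of_descent_configuration W₀ ha₁ ha₃ hA₂ hA₄ he hk hℓ'

end Summit.BirchSwinnertonDyer.BirchSwinnertonDyer.Theorems.ManinLocalTwoThree

end
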